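import Mathlib

/-!
# Solo (informed) rung s38/1: a Noetherian Jacobson ring with finitely many maximal ideals is Artinian

This is the commutative-algebra LEMMA inside step (4) of PROPOSITION Z (`work/s37/FINDING_Z.md` §Z3,
claim c363; paper `EtaleDirection.md` (13′)): for a complete Noetherian local `ℤ_p`-algebra `R` with
finite residue field, `R[1/p]` is Noetherian and Jacobson, its maximal ideals are the Galois orbits of the
`ℚ̄_p`-points, and when there are finitely many of them `R[1/p]` is Artinian, so that
`R[1/p]_red = ∏_x k(x)`.  The abstract statement proved here:

* `soloInformed_isMaximal_of_isPrime_of_finite_maximal`: in a Jacobson ring whose set of maximal ideals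
  is finite, every prime ideal is maximal (a prime is the intersection of the finitely many maximal
  ideals above it, and a prime containing a finite intersection contains one of the terms);
* `soloInformed_krullDimLE_zero_of_finite_maximal`: hence Krull dimension `≤ 0`;
* `soloInformed_isArtinianRing_of_finite_maximal`: hence, if also Noetherian, Artinian
  (Mathlib `isArtinianRing_iff_isNoetherianRing_krullDimLE_zero`), with the `Finite (MaximalSpectrum R)`
  phrasing `soloInformed_isArtinianRing_of_finite_maximalSpectrum` and the converse bookkeeping
  `soloInformed_isArtinianRing_iff_finite_maximalSpectrum` (for Noetherian Jacobson rings,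
  Artinian ↔ finitely many maximal ideals);
* `soloInformed_nonempty_equivPi_of_finite_maximal`: if moreover reduced, `R` is the finite product of its
  residue fields (Mathlib `IsArtinianRing.equivPi`).

No number theory is used; these are the bookkeeping facts the pencil proof of PROPOSITION Z (ii) invokes.
-/

namespace Summit.Langlands.Langlands.Theorems

variable {R : Type*} [CommRing R]

/-- In a Jacobson ring with finitely many maximal ideals, every prime ideal is maximal. -/
theorem soloInformed_isMaximal_of_isPrime_of_finite_maximal [IsJacobsonRing R]
    (hfin : {M : Ideal R | M.IsMaximal}.Finite) {P : Ideal R} (hP : P.IsPrime) : P.IsMaximal := by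
  classical
  -- the maximal ideals above `P` form a finite set `S`, and `P = sInf S` (Jacobson property)
  have hSfin : {M : Ideal R | P ≤ M ∧ M.IsMaximal}.Finite := hfin.subset fun M hM => hM.2
  have hPJ : P.jacobson = P := IsJacobsonRing.out ‹_› hP.isRadical
  have hPeq : hSfin.toFinset.inf id = P := by
    rw [Finset.inf_id_eq_sInf, Set.Finite.coe_toFinset]
    exact hPJ
  -- a prime containing a finite intersection of ideals contains one of them
  obtain ⟨M, hMS, hMP⟩ := hP.inf_le'.mp hPeq.le
  rw [Set.Finite.mem_toFinset] at hMS
  obtain ⟨hPM, hM⟩ := hMS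
  have hPM' : P = M := le_antisymm hPM hMP
  rw [hPM']
  exact hM

/-- A Jacobson ring with finitely many maximal ideals has Krull dimension `≤ 0`. -/
theorem soloInformed_krullDimLE_zero_of_finite_maximal [IsJacobsonRing R]
    (hfin : {M : Ideal R | M.IsMaximal}.Finite) : Ring.KrullDimLE 0 R :=
  Ring.KrullDimLE.mk₀ fun _ hP => soloInformed_isMaximal_of_isPrime_of_finite_maximal hfin hP

/-- A Noetherian Jacobson ring with finitely many maximal ideals is Artinian. -/
theorem soloInformed_isArtinianRing_of_finite_maximal [IsNoetherianRing R] [IsJacobsonRing R]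
    (hfin : {M : Ideal R | M.IsMaximal}.Finite) : IsArtinianRing R :=
  isArtinianRing_iff_isNoetherianRing_krullDimLE_zero.mpr
    ⟨inferInstance, soloInformed_krullDimLE_zero_of_finite_maximal hfin⟩

/-- The set of maximal ideals is finite iff the maximal spectrum is a finite type. -/
theorem soloInformed_finite_setOf_isMaximal_iff :
    {M : Ideal R | M.IsMaximal}.Finite ↔ Finite (MaximalSpectrum R) := by
  rw [← Set.finite_coe_iff]
  constructor
  · intro h
    haveI : Finite {I : Ideal R // I.IsMaximal} := h
    exact Finite.of_equiv _ (MaximalSpectrum.equivSubtype R).symm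
  · intro h
    have : Finite {I : Ideal R // I.IsMaximal} :=
      Finite.of_equiv _ (MaximalSpectrum.equivSubtype R)
    exact this

/-- A Noetherian Jacobson ring with finite maximal spectrum is Artinian. -/
theorem soloInformed_isArtinianRing_of_finite_maximalSpectrum [IsNoetherianRing R]
    [IsJacobsonRing R] [Finite (MaximalSpectrum R)] : IsArtinianRing R :=
  soloInformed_isArtinianRing_of_finite_maximal
    (soloInformed_finite_setOf_isMaximal_iff.mpr ‹_›)

/-- For a Noetherian Jacobson ring: Artinian iff the maximal spectrum is finite. -/
theorem soloInformed_isArtinianRing_iff_finite_maximalSpectrum [IsNoetherianRing R]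
    [IsJacobsonRing R] : IsArtinianRing R ↔ Finite (MaximalSpectrum R) :=
  ⟨fun _ => inferInstance, fun _ => soloInformed_isArtinianRing_of_finite_maximalSpectrum⟩

/-- A reduced Noetherian Jacobson ring with finitely many maximal ideals is the (finite) product of its
residue fields at the maximal ideals. -/
theorem soloInformed_nonempty_equivPi_of_finite_maximal [IsNoetherianRing R] [IsJacobsonRing R]
    [IsReduced R] (hfin : {M : Ideal R | M.IsMaximal}.Finite) :
    Nonempty (R ≃ₐ[R] ∀ I : MaximalSpectrum R, R ⧸ I.asIdeal) :=
  haveI := soloInformed_isArtinianRing_of_finite_maximal hfin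
  ⟨IsArtinianRing.equivPi R⟩

end Summit.Langlands.Langlands.Theorems
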